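import Summits.ValiantsHypothesis.ValiantsHypothesis.Theorems.BarrierLeverPartitionMinorsChowEdgeStep

/-!
# Route BarrierLever — Chow witnesses for partition minors (item 20172, CPM): preliminaries for the
# DOUBLE STEP (supports of doubly lifted witnesses, double pull-backs, three layouts one witness)

Helper file (`--supports stmt-ValiantsHypothesis-20172`; cell valiant-natproofs, rung V4, 𝒟-side of
door (c); seat val-np-p4 gen 13).  Closes NO item.  Small lemmas consumed by `…ChowDoubleStep`:
`support_mul_vanish` (a product avoids the variables both factors avoid),
`support_rename_lift_castAdd/natAdd` (a lifted polynomial avoids the lifts of avoided variables),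
`preimage_succAbove_erase_succAbove`, `preimage₂_eq_of_erase₂_eq` (the double pull-back along
`a.succAbove`, `b.succAbove` only depends on the `{a, a.succAbove b}`-erased label), `erase₂_idem`,
and `exists_common_chow_witness₃` (three hit layouts are hit by one product of `h + h` affine forms;
the polynomial method of `…GenericChowProduct`, cf. `exists_common_chow_witness₂`).

WHAT THIS IS NOT: bookkeeping only; nothing on items 20172 / 20195 / 19717, on crux
stmt-ValiantsHypothesis-14610, or on `VP` versus `VNP`.
-/

set_option linter.dupNamespace false

namespace Summit.ValiantsHypothesis.ValiantsHypothesis.Theorems.BarrierLever.ChowFactor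

open Finset MvPolynomial

noncomputable section

variable {h : ℕ}

/-! ## 1. Supports and double pull-backs -/

/-- A product avoids the variables avoided by both factors. -/
theorem support_mul_vanish {σ R : Type*} [CommSemiring R] [DecidableEq σ] (P : σ → Prop)
    (f g : MvPolynomial σ R) (hf : ∀ m ∈ f.support, ∀ v, P v → m v = 0)
    (hg : ∀ m ∈ g.support, ∀ v, P v → m v = 0) :
    ∀ m ∈ (f * g).support, ∀ v, P v → m v = 0 := by
  intro m hm v hv
  have hm' := MvPolynomial.support_mul f g hm
  rw [Finset.mem_add] at hm'
  obtain ⟨m₁, hm₁, m₂, hm₂, rfl⟩ := hm'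
  rw [Finsupp.add_apply, hf m₁ hm₁ v hv, hg m₂ hm₂ v hv, add_zero]

/-- A lifted polynomial avoids the lift of every variable the original avoids (x-side). -/
theorem support_rename_lift_castAdd {R : Type*} [CommSemiring R] (a c : Fin (h + 1)) (b : Fin h)
    (P : MvPolynomial (Fin (h + h)) R) (hP : ∀ m ∈ P.support, m (Fin.castAdd h b) = 0) :
    ∀ m ∈ (rename (Fin.append (fun b : Fin h => Fin.castAdd (h + 1) (a.succAbove b))
        (fun d : Fin h => Fin.natAdd (h + 1) (c.succAbove d))) P).support,
      m (Fin.castAdd (h + 1) (a.succAbove b)) = 0 := by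
  classical
  intro m hm
  rw [support_rename_of_injective (lift_injective a c)] at hm
  obtain ⟨m', hm', rfl⟩ := Finset.mem_image.mp hm
  rw [← lift_apply_castAdd a c b, Finsupp.mapDomain_apply (lift_injective a c)]
  exact hP m' hm'

/-- A lifted polynomial avoids the lift of every variable the original avoids (y-side). -/
theorem support_rename_lift_natAdd {R : Type*} [CommSemiring R] (a c : Fin (h + 1)) (d : Fin h)
    (P : MvPolynomial (Fin (h + h)) R) (hP : ∀ m ∈ P.support, m (Fin.natAdd h d) = 0) :
    ∀ m ∈ (rename (Fin.append (fun b : Fin h => Fin.castAdd (h + 1) (a.succAbove b))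
        (fun d : Fin h => Fin.natAdd (h + 1) (c.succAbove d))) P).support,
      m (Fin.natAdd (h + 1) (c.succAbove d)) = 0 := by
  classical
  intro m hm
  rw [support_rename_of_injective (lift_injective a c)] at hm
  obtain ⟨m', hm', rfl⟩ := Finset.mem_image.mp hm
  rw [← lift_apply_natAdd a c d, Finsupp.mapDomain_apply (lift_injective a c)]
  exact hP m' hm'

/-- Pulling back along `a.succAbove` turns the erasure of `a.succAbove b` into the erasure of `b`. -/
theorem preimage_succAbove_erase_succAbove (a : Fin (h + 1)) (b : Fin h) (S : Finset (Fin (h + 1))) :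
    (S.erase (a.succAbove b)).preimage a.succAbove Fin.succAbove_right_injective.injOn =
      (S.preimage a.succAbove Fin.succAbove_right_injective.injOn).erase b := by
  ext k
  simp [Finset.mem_preimage, Finset.mem_erase]

/-- The double pull-back only depends on the `{a, a.succAbove b}`-erased label. -/
theorem preimage₂_eq_of_erase₂_eq (a : Fin (h + 2)) (b : Fin (h + 1)) {S T : Finset (Fin (h + 2))}
    (he : (S.erase a).erase (a.succAbove b) = (T.erase a).erase (a.succAbove b)) :
    ((S.preimage a.succAbove Fin.succAbove_right_injective.injOn).preimage b.succAbove
        Fin.succAbove_right_injective.injOn) =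
      ((T.preimage a.succAbove Fin.succAbove_right_injective.injOn).preimage b.succAbove
        Fin.succAbove_right_injective.injOn) := by
  have key : ∀ U : Finset (Fin (h + 2)),
      ((U.preimage a.succAbove Fin.succAbove_right_injective.injOn).preimage b.succAbove
        Fin.succAbove_right_injective.injOn) =
      ((((U.erase a).erase (a.succAbove b)).preimage a.succAbove
        Fin.succAbove_right_injective.injOn).preimage b.succAbove
          Fin.succAbove_right_injective.injOn) := by
    intro U
    rw [preimage_succAbove_erase_succAbove, preimage_succAbove_erase, preimage_succAbove_erase]
  rw [key S, key T, he]

/-- Erasing twice more changes nothing. -/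
theorem erase₂_idem {α : Type*} [DecidableEq α] (S : Finset α) (x y : α) :
    (((S.erase x).erase y).erase x).erase y = (S.erase x).erase y := by
  ext z
  simp only [Finset.mem_erase]
  tauto

/-! ## 2. Three layouts, one witness -/

/-- Three hit layouts are hit by one product (the polynomial method of `…GenericChowProduct`). -/
theorem exists_common_chow_witness₃ {r₁ r₂ r₃ : ℕ} (U₁ W₁ : Fin r₁ → Finset (Fin h))
    (U₂ W₂ : Fin r₂ → Finset (Fin h)) (U₃ W₃ : Fin r₃ → Finset (Fin h))
    (h₁ : ∃ ℓ : Fin (h + h) → MvPolynomial (Fin (h + h)) ℂ, (∀ k, (ℓ k).totalDegree ≤ 1) ∧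
      (Matrix.of fun i j : Fin r₁ => coeff
        (∑ b ∈ U₁ i, Finsupp.single (Fin.castAdd h b) 1 + ∑ d ∈ W₁ j, Finsupp.single (Fin.natAdd h d) 1)
        (∏ k, ℓ k)).det ≠ 0)
    (h₂ : ∃ ℓ : Fin (h + h) → MvPolynomial (Fin (h + h)) ℂ, (∀ k, (ℓ k).totalDegree ≤ 1) ∧
      (Matrix.of fun i j : Fin r₂ => coeff
        (∑ b ∈ U₂ i, Finsupp.single (Fin.castAdd h b) 1 + ∑ d ∈ W₂ j, Finsupp.single (Fin.natAdd h d) 1)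
        (∏ k, ℓ k)).det ≠ 0)
    (h₃ : ∃ ℓ : Fin (h + h) → MvPolynomial (Fin (h + h)) ℂ, (∀ k, (ℓ k).totalDegree ≤ 1) ∧
      (Matrix.of fun i j : Fin r₃ => coeff
        (∑ b ∈ U₃ i, Finsupp.single (Fin.castAdd h b) 1 + ∑ d ∈ W₃ j, Finsupp.single (Fin.natAdd h d) 1)
        (∏ k, ℓ k)).det ≠ 0) :
    ∃ ℓ : Fin (h + h) → MvPolynomial (Fin (h + h)) ℂ, (∀ k, (ℓ k).totalDegree ≤ 1) ∧
      (Matrix.of fun i j : Fin r₁ => coeff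
        (∑ b ∈ U₁ i, Finsupp.single (Fin.castAdd h b) 1 + ∑ d ∈ W₁ j, Finsupp.single (Fin.natAdd h d) 1)
        (∏ k, ℓ k)).det ≠ 0 ∧
      (Matrix.of fun i j : Fin r₂ => coeff
        (∑ b ∈ U₂ i, Finsupp.single (Fin.castAdd h b) 1 + ∑ d ∈ W₂ j, Finsupp.single (Fin.natAdd h d) 1)
        (∏ k, ℓ k)).det ≠ 0 ∧
      (Matrix.of fun i j : Fin r₃ => coeff
        (∑ b ∈ U₃ i, Finsupp.single (Fin.castAdd h b) 1 + ∑ d ∈ W₃ j, Finsupp.single (Fin.natAdd h d) 1)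
        (∏ k, ℓ k)).det ≠ 0 := by
  classical
  have hP₁ := genericChow_det_ne_zero_of_hit U₁ W₁ h₁
  have hP₂ := genericChow_det_ne_zero_of_hit U₂ W₂ h₂
  have hP₃ := genericChow_det_ne_zero_of_hit U₃ W₃ h₃
  have hprod := mul_ne_zero (mul_ne_zero hP₁ hP₂) hP₃
  obtain ⟨θ, hθ⟩ : ∃ θ : Fin (h + h) × Option (Fin (h + h)) → ℂ, eval θ (_ * _ * _) ≠ 0 := by
    by_contra hall
    push Not at hall
    exact hprod (MvPolynomial.funext fun θ => by rw [hall θ, map_zero])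
  rw [map_mul, map_mul] at hθ
  refine ⟨fun k => C (θ (k, none)) + ∑ v : Fin (h + h), C (θ (k, some v)) * X v,
    fun k => totalDegree_affine_le _ _, ?_, ?_, ?_⟩
  · have e := left_ne_zero_of_mul (left_ne_zero_of_mul hθ)
    rw [eval_det_coeff_genericChow θ U₁ W₁] at e
    exact e
  · have e := right_ne_zero_of_mul (left_ne_zero_of_mul hθ)
    rw [eval_det_coeff_genericChow θ U₂ W₂] at e
    exact e
  · have e := right_ne_zero_of_mul hθ
    rw [eval_det_coeff_genericChow θ U₃ W₃] at e
    exact e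

end

end Summit.ValiantsHypothesis.ValiantsHypothesis.Theorems.BarrierLever.ChowFactor
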